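import Mathlib
import Literature.Analysis.FluidPDE.TaoCascadeODEProofs
import Literature.Analysis.FluidPDE.Tao2016AveragedNS.RestartedCascadeFlows
import Literature.Analysis.ODE.GlobalExistence
import Literature.Analysis.ODE.AutonomousContinuation
import Literature.Analysis.ODE.MaximalTime
import HarnessLib

/-!
# Tao 2016, §4: the cascade lattice as an ODE in a weighted sup-norm Banach space

T. Tao, *Finite time blowup for an averaged three-dimensional Navier–Stokes equation*, J. Amer. Math.
Soc. **29** (2016) 601–674 = arXiv:1402.0290v3, §4: the infinite system of ODE (4.8) (exact, inviscid
form (4.12)) `∂ₜ X_{i,n} = quadTerm_{i,n}(X)` driven by a table of structure constants on the shift set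
`S`, with the gains `(1+ε₀)^{5n/2}`. The gains are unbounded in `n`, so the right-hand side is not a
Lipschitz vector field on `ℓ^∞`; it becomes one after the change of variables `T_{i,k} = w_k X_{i,k}`
for a weight `w` growing super-geometrically ahead of the front (the weights of the tree's certificate
format `TaoCascade.GapData₂`, e.g. Gaussian `2^{k²/2+bk}`), precisely when the three ratios
`(1+ε₀)^{5k/2}/w_k`, `(1+ε₀)^{5k/2}/w_{k+1}`, `(1+ε₀)^{5(k-1)/2} w_k/w_{k-1}²` are bounded
(`WeightRatiosLE`). This module (MODEL lattice only; nothing about the Navier–Stokes equations) supplies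

* `weightedField ε₀ α w … : (Fin m × ℤ →ᵇ ℝ) → (Fin m × ℤ →ᵇ ℝ)`, the conjugated vector field
  `T ↦ (w_k · quadTerm_{i,k}(T/w))`, with `weightedField_apply`;
* `abs_weightedFieldFun_sub_le` / `lipschitzOnWith_weightedField` — it is Lipschitz on every ball
  (constant `8 m² M_α A R` on `‖T‖ ≤ R`), and `norm_weightedField_le` (quadratic growth);
* `exists_exact_pseudoFlowOn_of_apriori_bound` — CONTINUATION CRITERION: if every weighted solution from
  `T₀ = w·S₀` on any `[0,s] ⊆ [0,c]` stays in the ball `‖T‖ ≤ B`, then an EXACT flow of the lattice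
  (`PseudoFlowOn c ε₀ α 0 0 S₀ (½S₀²) 0 S (½S²)`, the (exist₀)/(front) clause shape of the tree's
  certificates) exists on the whole window `[0,c]`, provided `sup_k (1+(1+ε₀)^{10k})/w_k < ∞`
  (the a priori decay (4.5) is then inherited from the weighted bound). Standard ODE theory in Banach
  spaces (Picard–Lindelöf + continuation, tree module `Literature.Analysis.ODE.GlobalExistence`,
  Teschl 2012 Cor. 2.16) applied to Tao's lattice;
* `weightedField_apriori_short` / `exists_exact_pseudoFlowOn_short` — the short-window a priori bound
  (maximal-time continuity argument, tree module `Literature.Analysis.ODE.MaximalTime`) and hence LOCAL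
  EXISTENCE of exact lattice flows from every weighted-bounded state, with an explicit window.

Nothing is asserted about any particular table; the a priori bound is a HYPOTHESIS (for a cascading
table it fails beyond the blow-up time).
-/

noncomputable section

open Set Metric Filter BoundedContinuousFunction
open scoped NNReal Topology

namespace Literature.Analysis.FluidPDE

namespace TaoCascade

variable {m : ℕ}

/-! ### Admissible weights and the conjugated field -/

/-- **Admissible weight ratios.** Positive weights `w` with the three gain/weight ratios of the
conjugated lattice field bounded by `A`: same-shell `(1+ε₀)^{5k/2}/w_k`, back-reaction
`(1+ε₀)^{5k/2}/w_{k+1}`, pump `(1+ε₀)^{5(k-1)/2} w_k/w_{k-1}²`. (Gaussian weights ahead of the front and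
bounded weights behind it are admissible at every `ε₀ ≥ 0`.) [cite: Tao2016AveragedNS, §4 (4.8) (the gains); cell vocabulary] -/
def WeightRatiosLE (ε₀ : ℝ) (w : ℤ → ℝ) (A : ℝ) : Prop :=
  (∀ k : ℤ, 0 < w k) ∧ ∀ k : ℤ,
    (1 + ε₀) ^ ((5 : ℝ) * k / 2) / w k ≤ A ∧
    (1 + ε₀) ^ ((5 : ℝ) * k / 2) / w (k + 1) ≤ A ∧
    (1 + ε₀) ^ ((5 : ℝ) * ((k : ℝ) - 1) / 2) * w k / w (k - 1) ^ 2 ≤ A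

/-- The components of the CONJUGATED lattice field in the weighted variables `T_{i,k} = w_k X_{i,k}`:
`(i,k) ↦ w_k · quadTerm_{i,k}(T/w)`. [cite: Tao2016AveragedNS, §4 (4.8), (4.12)] -/
def weightedFieldFun (ε₀ : ℝ) (α : Fin m → Fin m → Fin m → ℤ × ℤ × ℤ → ℝ) (w : ℤ → ℝ)
    (T : Fin m × ℤ →ᵇ ℝ) : Fin m × ℤ → ℝ :=
  fun p => w p.2 * quadTerm ε₀ α (fun j n (_ : ℝ) => T (j, n) / w n) p.1 p.2 0

/-- The cascade nonlinearity written out over the four shifts of `S`. [cite: Tao2016AveragedNS, §4 (4.8)] -/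
theorem quadTerm_four_shifts (ε₀ : ℝ) (α : Fin m → Fin m → Fin m → ℤ × ℤ × ℤ → ℝ)
    (X : Fin m → ℤ → ℝ → ℝ) (i : Fin m) (n : ℤ) (t : ℝ) :
    quadTerm ε₀ α X i n t =
      (1 + ε₀) ^ ((5 : ℝ) * n / 2) *
          ∑ i₁, ∑ i₂, (α i₁ i₂ i (0, 0, 0) * (X i₁ n t * X i₂ n t) +
            α i₁ i₂ i (1, 0, 0) * (X i₁ (n + 1) t * X i₂ n t) +
            α i₁ i₂ i (0, 1, 0) * (X i₁ n t * X i₂ (n + 1) t)) +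
        (1 + ε₀) ^ ((5 : ℝ) * ((n : ℝ) - 1) / 2) *
          ∑ i₁, ∑ i₂, α i₁ i₂ i (0, 0, 1) * (X i₁ (n - 1) t * X i₂ (n - 1) t) := by
  unfold quadTerm
  simp only [sum_shiftSet, sub_zero, add_zero, Int.cast_zero, Int.cast_one, Finset.mul_sum,
    ← Finset.sum_add_distrib]
  refine Finset.sum_congr rfl fun i₁ _ => Finset.sum_congr rfl fun i₂ _ => ?_
  ring

/-- A bilinear block estimate: `|Σ c (a b) − Σ c (a' b')| ≤ m² M_c (R_a d_b + d_a R_b)` from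
`|c| ≤ M_c`, `|a| ≤ R_a`, `|b'| ≤ R_b`, `|a − a'| ≤ d_a`, `|b − b'| ≤ d_b`. [folklore] -/
private theorem abs_sum_sum_bilin_sub_le {c : Fin m → Fin m → ℝ} {a b a' b' : Fin m → ℝ}
    {Mc Ra Rb da db : ℝ} (hMc : 0 ≤ Mc) (hRa : 0 ≤ Ra)
    (hc : ∀ i j, |c i j| ≤ Mc) (ha : ∀ i, |a i| ≤ Ra) (hb' : ∀ j, |b' j| ≤ Rb)
    (hda : ∀ i, |a i - a' i| ≤ da) (hdb' : ∀ j, |b j - b' j| ≤ db) :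
    |∑ i, ∑ j, c i j * (a i * b j) - ∑ i, ∑ j, c i j * (a' i * b' j)| ≤
      (m : ℝ) ^ 2 * Mc * (Ra * db + da * Rb) := by
  rw [← Finset.sum_sub_distrib]
  simp_rw [← Finset.sum_sub_distrib, ← mul_sub]
  have hterm : ∀ i j, |c i j * (a i * b j - a' i * b' j)| ≤ Mc * (Ra * db + da * Rb) := by
    intro i j
    have hda0 : 0 ≤ da := (abs_nonneg _).trans (hda i)
    have hRb0 : 0 ≤ Rb := (abs_nonneg _).trans (hb' j)
    rw [abs_mul]
    have h1 : a i * b j - a' i * b' j = a i * (b j - b' j) + (a i - a' i) * b' j := by ring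
    have h2 : |a i * (b j - b' j) + (a i - a' i) * b' j| ≤ Ra * db + da * Rb := by
      calc |a i * (b j - b' j) + (a i - a' i) * b' j|
          ≤ |a i * (b j - b' j)| + |(a i - a' i) * b' j| := abs_add_le _ _
        _ = |a i| * |b j - b' j| + |a i - a' i| * |b' j| := by rw [abs_mul, abs_mul]
        _ ≤ Ra * db + da * Rb := by
            have h3 := ha i
            have h4 := hb' j
            have h5 := hda i
            have h6 := hdb' j
            gcongr
    rw [h1]
    exact mul_le_mul (hc i j) h2 (abs_nonneg _) hMc
  calc |∑ i, ∑ j, c i j * (a i * b j - a' i * b' j)|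
      ≤ ∑ i, |∑ j, c i j * (a i * b j - a' i * b' j)| := Finset.abs_sum_le_sum_abs _ _
    _ ≤ ∑ i, ∑ j, |c i j * (a i * b j - a' i * b' j)| :=
        Finset.sum_le_sum fun i _ => Finset.abs_sum_le_sum_abs _ _
    _ ≤ ∑ _i : Fin m, ∑ _j : Fin m, Mc * (Ra * db + da * Rb) :=
        Finset.sum_le_sum fun i _ => Finset.sum_le_sum fun j _ => hterm i j
    _ = (m : ℝ) ^ 2 * Mc * (Ra * db + da * Rb) := by
        rw [Finset.sum_const, Finset.sum_const, Finset.card_univ, Fintype.card_fin, nsmul_eq_mul,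
          nsmul_eq_mul]
        ring

/-- The conjugated field written out over the four shifts (same-shell, two back-reactions, pump).
[cite: Tao2016AveragedNS, §4 (4.8)] -/
theorem weightedFieldFun_eq (ε₀ : ℝ) (α : Fin m → Fin m → Fin m → ℤ × ℤ × ℤ → ℝ) (w : ℤ → ℝ)
    (T : Fin m × ℤ →ᵇ ℝ) (i : Fin m) (k : ℤ) :
    weightedFieldFun ε₀ α w T (i, k) =
      w k * ((1 + ε₀) ^ ((5 : ℝ) * k / 2) *
          ((∑ i₁, ∑ i₂, α i₁ i₂ i (0, 0, 0) * (T (i₁, k) / w k * (T (i₂, k) / w k))) +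
            (∑ i₁, ∑ i₂, α i₁ i₂ i (1, 0, 0) * (T (i₁, k + 1) / w (k + 1) * (T (i₂, k) / w k))) +
            ∑ i₁, ∑ i₂, α i₁ i₂ i (0, 1, 0) * (T (i₁, k) / w k * (T (i₂, k + 1) / w (k + 1)))) +
        (1 + ε₀) ^ ((5 : ℝ) * ((k : ℝ) - 1) / 2) *
          ∑ i₁, ∑ i₂, α i₁ i₂ i (0, 0, 1) * (T (i₁, k - 1) / w (k - 1) * (T (i₂, k - 1) / w (k - 1)))) := by
  unfold weightedFieldFun
  rw [quadTerm_four_shifts]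
  simp only [Finset.sum_add_distrib]

/-- Coordinates of a bounded function are bounded by its norm, in weighted form. [folklore] -/
private theorem abs_apply_div_le {w : ℤ → ℝ} (hw : ∀ k, 0 < w k) {T : Fin m × ℤ →ᵇ ℝ} {R : ℝ}
    (hT : ‖T‖ ≤ R) (j : Fin m) (n : ℤ) : |T (j, n) / w n| ≤ R / w n := by
  rw [abs_div, abs_of_pos (hw n)]
  exact div_le_div_of_nonneg_right ((Real.norm_eq_abs _ ▸ T.norm_coe_le_norm (j, n)).trans hT)
    (hw n).le

/-- Differences of weighted coordinates are bounded by the distance. [folklore] -/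
private theorem abs_apply_div_sub_le {w : ℤ → ℝ} (hw : ∀ k, 0 < w k) (T T' : Fin m × ℤ →ᵇ ℝ)
    (j : Fin m) (n : ℤ) : |T (j, n) / w n - T' (j, n) / w n| ≤ ‖T - T'‖ / w n := by
  rw [← sub_div, abs_div, abs_of_pos (hw n), ← BoundedContinuousFunction.sub_apply]
  exact div_le_div_of_nonneg_right (Real.norm_eq_abs _ ▸ (T - T').norm_coe_le_norm (j, n)) (hw n).le

/-- **The conjugated field is Lipschitz on balls, coordinatewise**: for `‖T‖, ‖T'‖ ≤ R`,
`|F(T)_{i,k} − F(T')_{i,k}| ≤ 8 m² M_α A R ‖T − T'‖`. [cite: Tao2016AveragedNS, §4 (4.8); folklore estimate] -/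
theorem abs_weightedFieldFun_sub_le {ε₀ A Mα R : ℝ} {α : Fin m → Fin m → Fin m → ℤ × ℤ × ℤ → ℝ}
    {w : ℤ → ℝ} (hε : 0 ≤ 1 + ε₀) (hw : WeightRatiosLE ε₀ w A) (hMα : 0 ≤ Mα)
    (hα : ∀ i₁ i₂ i₃ μ, |α i₁ i₂ i₃ μ| ≤ Mα) (hR : 0 ≤ R) {T T' : Fin m × ℤ →ᵇ ℝ}
    (hT : ‖T‖ ≤ R) (hT' : ‖T'‖ ≤ R) (i : Fin m) (k : ℤ) :
    |weightedFieldFun ε₀ α w T (i, k) - weightedFieldFun ε₀ α w T' (i, k)| ≤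
      8 * (m : ℝ) ^ 2 * Mα * A * R * ‖T - T'‖ := by
  obtain ⟨hwpos, hrat⟩ := hw
  obtain ⟨hr1, hr2, hr3⟩ := hrat k
  set d : ℝ := ‖T - T'‖ with hd
  have hd0 : 0 ≤ d := norm_nonneg _
  have hS : ∀ j n, |T (j, n) / w n| ≤ R / w n := abs_apply_div_le hwpos hT
  have hS' : ∀ j n, |T' (j, n) / w n| ≤ R / w n := abs_apply_div_le hwpos hT'
  have hdS : ∀ j n, |T (j, n) / w n - T' (j, n) / w n| ≤ d / w n :=
    abs_apply_div_sub_le hwpos T T'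
  have hRw : ∀ n, 0 ≤ R / w n := fun n => div_nonneg hR (hwpos n).le
  -- the four bilinear blocks
  have blk : ∀ (μ : ℤ × ℤ × ℤ) (n₁ n₂ : ℤ),
      |∑ i₁, ∑ i₂, α i₁ i₂ i μ * (T (i₁, n₁) / w n₁ * (T (i₂, n₂) / w n₂)) -
        ∑ i₁, ∑ i₂, α i₁ i₂ i μ * (T' (i₁, n₁) / w n₁ * (T' (i₂, n₂) / w n₂))| ≤
        (m : ℝ) ^ 2 * Mα * (R / w n₁ * (d / w n₂) + d / w n₁ * (R / w n₂)) :=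
    fun μ n₁ n₂ => abs_sum_sum_bilin_sub_le hMα (hRw n₁) (fun i₁ i₂ => hα i₁ i₂ i μ)
      (fun i₁ => hS i₁ n₁) (fun i₂ => hS' i₂ n₂) (fun i₁ => hdS i₁ n₁) (fun i₂ => hdS i₂ n₂)
  have hA := blk (0, 0, 0) k k
  have hB := blk (1, 0, 0) (k + 1) k
  have hC := blk (0, 1, 0) k (k + 1)
  have hD := blk (0, 0, 1) (k - 1) (k - 1)
  rw [weightedFieldFun_eq, weightedFieldFun_eq]
  -- abbreviate the eight sums
  obtain ⟨SA, hSA⟩ : ∃ x : ℝ, x = ∑ i₁, ∑ i₂, α i₁ i₂ i (0, 0, 0) * (T (i₁, k) / w k * (T (i₂, k) / w k)) :=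
    ⟨_, rfl⟩
  obtain ⟨SB, hSB⟩ : ∃ x : ℝ,
      x = ∑ i₁, ∑ i₂, α i₁ i₂ i (1, 0, 0) * (T (i₁, k + 1) / w (k + 1) * (T (i₂, k) / w k)) := ⟨_, rfl⟩
  obtain ⟨SC, hSC⟩ : ∃ x : ℝ,
      x = ∑ i₁, ∑ i₂, α i₁ i₂ i (0, 1, 0) * (T (i₁, k) / w k * (T (i₂, k + 1) / w (k + 1))) := ⟨_, rfl⟩
  obtain ⟨SD, hSD⟩ : ∃ x : ℝ,
      x = ∑ i₁, ∑ i₂, α i₁ i₂ i (0, 0, 1) * (T (i₁, k - 1) / w (k - 1) * (T (i₂, k - 1) / w (k - 1))) :=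
    ⟨_, rfl⟩
  obtain ⟨SA', hSA'⟩ : ∃ x : ℝ,
      x = ∑ i₁, ∑ i₂, α i₁ i₂ i (0, 0, 0) * (T' (i₁, k) / w k * (T' (i₂, k) / w k)) := ⟨_, rfl⟩
  obtain ⟨SB', hSB'⟩ : ∃ x : ℝ,
      x = ∑ i₁, ∑ i₂, α i₁ i₂ i (1, 0, 0) * (T' (i₁, k + 1) / w (k + 1) * (T' (i₂, k) / w k)) := ⟨_, rfl⟩
  obtain ⟨SC', hSC'⟩ : ∃ x : ℝ,
      x = ∑ i₁, ∑ i₂, α i₁ i₂ i (0, 1, 0) * (T' (i₁, k) / w k * (T' (i₂, k + 1) / w (k + 1))) := ⟨_, rfl⟩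
  obtain ⟨SD', hSD'⟩ : ∃ x : ℝ,
      x = ∑ i₁, ∑ i₂, α i₁ i₂ i (0, 0, 1) * (T' (i₁, k - 1) / w (k - 1) * (T' (i₂, k - 1) / w (k - 1))) :=
    ⟨_, rfl⟩
  rw [← hSA, ← hSA'] at hA
  rw [← hSB, ← hSB'] at hB
  rw [← hSC, ← hSC'] at hC
  rw [← hSD, ← hSD'] at hD
  rw [← hSA, ← hSB, ← hSC, ← hSD, ← hSA', ← hSB', ← hSC', ← hSD']
  -- positivity of gains and weights
  set L : ℝ := (1 + ε₀) ^ ((5 : ℝ) * k / 2) with hL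
  set L' : ℝ := (1 + ε₀) ^ ((5 : ℝ) * ((k : ℝ) - 1) / 2) with hL'
  have hL0 : 0 ≤ L := Real.rpow_nonneg hε _
  have hL'0 : 0 ≤ L' := Real.rpow_nonneg hε _
  have hwk : 0 < w k := hwpos k
  have hwk1 : 0 < w (k + 1) := hwpos (k + 1)
  have hwk0 : 0 < w (k - 1) := hwpos (k - 1)
  -- rewrite the difference
  have hsplit : w k * (L * (SA + SB + SC) + L' * SD) - w k * (L * (SA' + SB' + SC') + L' * SD') =
      w k * L * ((SA - SA') + (SB - SB') + (SC - SC')) + w k * L' * (SD - SD') := by ring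
  rw [hsplit]
  have hm0 : 0 ≤ (m : ℝ) ^ 2 * Mα := by positivity
  -- the weighted block bounds
  have eA : w k * L * ((m : ℝ) ^ 2 * Mα * (R / w k * (d / w k) + d / w k * (R / w k))) =
      L / w k * (2 * ((m : ℝ) ^ 2 * Mα) * R * d) := by
    field_simp
    ring
  have eB : w k * L * ((m : ℝ) ^ 2 * Mα * (R / w (k + 1) * (d / w k) + d / w (k + 1) * (R / w k))) =
      L / w (k + 1) * (2 * ((m : ℝ) ^ 2 * Mα) * R * d) := by
    field_simp
    ring
  have eC : w k * L * ((m : ℝ) ^ 2 * Mα * (R / w k * (d / w (k + 1)) + d / w k * (R / w (k + 1)))) =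
      L / w (k + 1) * (2 * ((m : ℝ) ^ 2 * Mα) * R * d) := by
    field_simp
    ring
  have eD : w k * L' * ((m : ℝ) ^ 2 * Mα * (R / w (k - 1) * (d / w (k - 1)) +
      d / w (k - 1) * (R / w (k - 1)))) = L' * w k / w (k - 1) ^ 2 * (2 * ((m : ℝ) ^ 2 * Mα) * R * d) := by
    field_simp
    ring
  have hK0 : 0 ≤ 2 * ((m : ℝ) ^ 2 * Mα) * R * d := by positivity
  have hwL : 0 ≤ w k * L := mul_nonneg hwk.le hL0
  have hwL' : 0 ≤ w k * L' := mul_nonneg hwk.le hL'0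
  have htri : |(SA - SA') + (SB - SB') + (SC - SC')| ≤ |SA - SA'| + |SB - SB'| + |SC - SC'| :=
    (abs_add_le _ _).trans (add_le_add (abs_add_le _ _) le_rfl)
  have h3 : |SA - SA'| + |SB - SB'| + |SC - SC'| ≤
      (m : ℝ) ^ 2 * Mα * (R / w k * (d / w k) + d / w k * (R / w k)) +
        (m : ℝ) ^ 2 * Mα * (R / w (k + 1) * (d / w k) + d / w (k + 1) * (R / w k)) +
        (m : ℝ) ^ 2 * Mα * (R / w k * (d / w (k + 1)) + d / w k * (R / w (k + 1))) :=
    add_le_add (add_le_add hA hB) hC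
  calc |w k * L * ((SA - SA') + (SB - SB') + (SC - SC')) + w k * L' * (SD - SD')|
      ≤ |w k * L * ((SA - SA') + (SB - SB') + (SC - SC'))| + |w k * L' * (SD - SD')| := abs_add_le _ _
    _ = w k * L * |(SA - SA') + (SB - SB') + (SC - SC')| + w k * L' * |SD - SD'| := by
        rw [abs_mul (w k * L), abs_mul (w k * L'), abs_of_nonneg hwL, abs_of_nonneg hwL']
    _ ≤ w k * L * (|SA - SA'| + |SB - SB'| + |SC - SC'|) + w k * L' * |SD - SD'| :=
        add_le_add (mul_le_mul_of_nonneg_left htri hwL) le_rfl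
    _ ≤ w k * L * ((m : ℝ) ^ 2 * Mα * (R / w k * (d / w k) + d / w k * (R / w k)) +
          (m : ℝ) ^ 2 * Mα * (R / w (k + 1) * (d / w k) + d / w (k + 1) * (R / w k)) +
          (m : ℝ) ^ 2 * Mα * (R / w k * (d / w (k + 1)) + d / w k * (R / w (k + 1)))) +
        w k * L' * ((m : ℝ) ^ 2 * Mα * (R / w (k - 1) * (d / w (k - 1)) +
          d / w (k - 1) * (R / w (k - 1)))) :=
        add_le_add (mul_le_mul_of_nonneg_left h3 hwL) (mul_le_mul_of_nonneg_left hD hwL')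
    _ = L / w k * (2 * ((m : ℝ) ^ 2 * Mα) * R * d) + L / w (k + 1) * (2 * ((m : ℝ) ^ 2 * Mα) * R * d) +
          L / w (k + 1) * (2 * ((m : ℝ) ^ 2 * Mα) * R * d) +
          L' * w k / w (k - 1) ^ 2 * (2 * ((m : ℝ) ^ 2 * Mα) * R * d) := by
        rw [mul_add, mul_add, eA, eB, eC, eD]
    _ ≤ A * (2 * ((m : ℝ) ^ 2 * Mα) * R * d) + A * (2 * ((m : ℝ) ^ 2 * Mα) * R * d) +
          A * (2 * ((m : ℝ) ^ 2 * Mα) * R * d) + A * (2 * ((m : ℝ) ^ 2 * Mα) * R * d) :=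
        add_le_add (add_le_add (add_le_add (mul_le_mul_of_nonneg_right hr1 hK0)
          (mul_le_mul_of_nonneg_right hr2 hK0)) (mul_le_mul_of_nonneg_right hr2 hK0))
          (mul_le_mul_of_nonneg_right hr3 hK0)
    _ = 8 * (m : ℝ) ^ 2 * Mα * A * R * d := by ring

/-- The conjugated field vanishes at the zero state. [folklore] -/
private theorem weightedFieldFun_zero (ε₀ : ℝ) (α : Fin m → Fin m → Fin m → ℤ × ℤ × ℤ → ℝ) (w : ℤ → ℝ)
    (p : Fin m × ℤ) : weightedFieldFun ε₀ α w 0 p = 0 := by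
  obtain ⟨i, k⟩ := p
  rw [weightedFieldFun_eq]
  simp

/-- **Quadratic bound on the conjugated field**, coordinatewise: `|F(T)_{i,k}| ≤ 8 m² M_α A ‖T‖²`.
[cite: Tao2016AveragedNS, §4 (4.8); folklore estimate] -/
theorem abs_weightedFieldFun_le {ε₀ A Mα : ℝ} {α : Fin m → Fin m → Fin m → ℤ × ℤ × ℤ → ℝ}
    {w : ℤ → ℝ} (hε : 0 ≤ 1 + ε₀) (hw : WeightRatiosLE ε₀ w A) (hMα : 0 ≤ Mα)
    (hα : ∀ i₁ i₂ i₃ μ, |α i₁ i₂ i₃ μ| ≤ Mα) (T : Fin m × ℤ →ᵇ ℝ) (p : Fin m × ℤ) :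
    |weightedFieldFun ε₀ α w T p| ≤ 8 * (m : ℝ) ^ 2 * Mα * A * ‖T‖ * ‖T‖ := by
  obtain ⟨i, k⟩ := p
  have h := abs_weightedFieldFun_sub_le hε hw hMα hα (norm_nonneg T) (T := T) (T' := 0) le_rfl
    (by simp) i k
  rwa [weightedFieldFun_zero, sub_zero, sub_zero] at h

/-- **The conjugated lattice field as a vector field on the Banach space `Fin m × ℤ →ᵇ ℝ`** (sup
norm): `T ↦ (w_k · quadTerm_{i,k}(T/w))_{(i,k)}`, well defined (bounded output) for admissible weights
and bounded structure constants. [cite: Tao2016AveragedNS, §4 (4.8), (4.12)] -/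
def weightedField {ε₀ A Mα : ℝ} {α : Fin m → Fin m → Fin m → ℤ × ℤ × ℤ → ℝ} {w : ℤ → ℝ}
    (hε : 0 ≤ 1 + ε₀) (hw : WeightRatiosLE ε₀ w A) (hMα : 0 ≤ Mα)
    (hα : ∀ i₁ i₂ i₃ μ, |α i₁ i₂ i₃ μ| ≤ Mα) :
    (Fin m × ℤ →ᵇ ℝ) → (Fin m × ℤ →ᵇ ℝ) :=
  fun T => ofNormedAddCommGroupDiscrete (weightedFieldFun ε₀ α w T)
    (8 * (m : ℝ) ^ 2 * Mα * A * ‖T‖ * ‖T‖)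
    fun p => (Real.norm_eq_abs _).trans_le (abs_weightedFieldFun_le hε hw hMα hα T p)

/-- Components of the conjugated field. [cite: Tao2016AveragedNS, §4 (4.8)] -/
theorem weightedField_apply {ε₀ A Mα : ℝ} {α : Fin m → Fin m → Fin m → ℤ × ℤ × ℤ → ℝ} {w : ℤ → ℝ}
    (hε : 0 ≤ 1 + ε₀) (hw : WeightRatiosLE ε₀ w A) (hMα : 0 ≤ Mα)
    (hα : ∀ i₁ i₂ i₃ μ, |α i₁ i₂ i₃ μ| ≤ Mα) (T : Fin m × ℤ →ᵇ ℝ) (i : Fin m) (k : ℤ) :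
    weightedField hε hw hMα hα T (i, k) =
      w k * quadTerm ε₀ α (fun j n (_ : ℝ) => T (j, n) / w n) i k 0 := rfl

/-- Norm bound of the conjugated field: `‖F(T)‖ ≤ 8 m² M_α A ‖T‖²` (the main term of (4.8) is a bounded
quadratic map in the weighted variables). [cite: Tao2016AveragedNS, §4 (4.8); estimate in cell vocabulary] -/
theorem norm_weightedField_le {ε₀ A Mα : ℝ} {α : Fin m → Fin m → Fin m → ℤ × ℤ × ℤ → ℝ} {w : ℤ → ℝ}
    (hε : 0 ≤ 1 + ε₀) (hw : WeightRatiosLE ε₀ w A) (hMα : 0 ≤ Mα)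
    (hα : ∀ i₁ i₂ i₃ μ, |α i₁ i₂ i₃ μ| ≤ Mα) (hA : 0 ≤ A) (T : Fin m × ℤ →ᵇ ℝ) :
    ‖weightedField hε hw hMα hα T‖ ≤ 8 * (m : ℝ) ^ 2 * Mα * A * ‖T‖ * ‖T‖ :=
  (norm_le (by positivity)).2 fun p =>
    (Real.norm_eq_abs _).trans_le (abs_weightedFieldFun_le hε hw hMα hα T p)

/-- **The conjugated field is Lipschitz on every ball** `‖T‖ ≤ R` of the weighted sup-norm space,
with constant `8 m² M_α A R` (the main term of (4.8) is locally Lipschitz in the weighted variables).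
[cite: Tao2016AveragedNS, §4 (4.8); estimate in cell vocabulary] -/
theorem lipschitzOnWith_weightedField {ε₀ A Mα R : ℝ} {α : Fin m → Fin m → Fin m → ℤ × ℤ × ℤ → ℝ}
    {w : ℤ → ℝ} (hε : 0 ≤ 1 + ε₀) (hw : WeightRatiosLE ε₀ w A) (hMα : 0 ≤ Mα)
    (hα : ∀ i₁ i₂ i₃ μ, |α i₁ i₂ i₃ μ| ≤ Mα) (hR : 0 ≤ R) :
    LipschitzOnWith (Real.toNNReal (8 * (m : ℝ) ^ 2 * Mα * A * R)) (weightedField hε hw hMα hα)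
      (closedBall 0 R) := by
  have hA : 0 ≤ A := by
    obtain ⟨hwpos, hrat⟩ := hw
    exact le_trans (div_nonneg (Real.rpow_nonneg hε _) (hwpos 0).le) (hrat 0).1
  refine LipschitzOnWith.of_dist_le_mul fun T hT T' hT' => ?_
  rw [mem_closedBall, dist_zero_right] at hT hT'
  have hK : 0 ≤ 8 * (m : ℝ) ^ 2 * Mα * A * R := by positivity
  rw [Real.coe_toNNReal _ hK]
  refine (dist_le (by positivity)).2 fun p => ?_
  obtain ⟨i, k⟩ := p
  rw [Real.dist_eq, dist_eq_norm]
  exact abs_weightedFieldFun_sub_le hε hw hMα hα hR hT hT' i k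

/-- `C¹` on a compact interval from a derivative within it that is continuous there. [folklore] -/
private theorem contDiffOn_one_Icc_of_hasDerivWithinAt {f f' : ℝ → ℝ} {a b : ℝ} (hab : a < b)
    (hf : ∀ t ∈ Icc a b, HasDerivWithinAt f (f' t) (Icc a b) t) (hf' : ContinuousOn f' (Icc a b)) :
    ContDiffOn ℝ 1 f (Icc a b) := by
  rw [show (1 : WithTop ℕ∞) = 0 + 1 from (zero_add 1).symm,
    contDiffOn_succ_iff_derivWithin (uniqueDiffOn_Icc hab)]
  refine ⟨fun t ht => (hf t ht).differentiableWithinAt, fun h => absurd h (by simp), ?_⟩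
  exact contDiffOn_zero.2
    (hf'.congr fun t ht => (hf t ht).derivWithin (uniqueDiffOn_Icc hab t ht))

/-- **CONTINUATION CRITERION ⇒ EXACT LATTICE FLOW ON THE WHOLE WINDOW.** Let the weights be admissible
with `(1 + (1+ε₀)^{10k})/w_k ≤ D`, the structure constants bounded by `M_α`, `0 < c`, and let
`T₀ = w·S₀` with `‖T₀‖ ≤ B`. If every solution of the conjugated equation `T' = F(T)` from `T₀` on any
`[0,s] ⊆ [0,c]` stays in the ball `‖T‖ ≤ B` (a priori bound — a HYPOTHESIS; it fails past the blow-up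
time of a cascading table), then the lattice admits an EXACT flow on `[0,c]` from `S₀`: a
`PseudoFlowOn c ε₀ α 0 0 S₀ (½S₀²) 0 S (½S²)` (zero defects, zero slack, energies `½S²`), with the
weighted bound `w_k |S_{i,k}(s)| ≤ B` throughout. Picard–Lindelöf + continuation in the Banach space
`Fin m × ℤ →ᵇ ℝ` (tree: `Literature.Analysis.ODE.solution_extend`). [cite: Tao2016AveragedNS, §4 Lemma 4.1 (4.5), (4.8)–(4.10), (4.12); Teschl2012, Cor. 2.16] -/
theorem exists_exact_pseudoFlowOn_of_apriori_bound {ε₀ A Mα D B c : ℝ}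
    {α : Fin m → Fin m → Fin m → ℤ × ℤ × ℤ → ℝ} {w : ℤ → ℝ}
    (hε : 0 ≤ 1 + ε₀) (hw : WeightRatiosLE ε₀ w A) (hMα : 0 ≤ Mα)
    (hα : ∀ i₁ i₂ i₃ μ, |α i₁ i₂ i₃ μ| ≤ Mα)
    (hD : ∀ k : ℤ, (1 + (1 + ε₀) ^ ((10 : ℝ) * k)) / w k ≤ D) (hc : 0 < c)
    (S₀ : Fin m → ℤ → ℝ) (T₀ : Fin m × ℤ →ᵇ ℝ) (hT₀ : ∀ i k, T₀ (i, k) = w k * S₀ i k)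
    (hB : ‖T₀‖ ≤ B)
    (hapriori : ∀ s ∈ Icc 0 c, ∀ T : ℝ → (Fin m × ℤ →ᵇ ℝ), T 0 = T₀ →
      (∀ t ∈ Icc 0 s, HasDerivWithinAt T (weightedField hε hw hMα hα (T t)) (Icc 0 s) t) →
        ∀ t ∈ Icc 0 s, ‖T t‖ ≤ B) :
    ∃ S : Fin m → ℤ → ℝ → ℝ,
      PseudoFlowOn c ε₀ α 0 0 S₀ (fun i k => (1 / 2) * S₀ i k ^ 2) (fun _ _ => 0) S
        (fun i k s => (1 / 2) * S i k s ^ 2) ∧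
      ∀ s ∈ Icc 0 c, ∀ i k, w k * |S i k s| ≤ B := by
  obtain ⟨hwpos, hrat⟩ := hw
  have hA : 0 ≤ A := le_trans (div_nonneg (Real.rpow_nonneg hε _) (hwpos 0).le) (hrat 0).1
  have hB0 : 0 ≤ B := (norm_nonneg _).trans hB
  set F := weightedField hε ⟨hwpos, hrat⟩ hMα hα with hF
  -- Lipschitz and boundedness data on the ball of radius `B + 1`
  have hlip : ∀ t ∈ Icc (0 : ℝ) c, LipschitzOnWith (Real.toNNReal (8 * (m : ℝ) ^ 2 * Mα * A * (B + 1)))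
      ((fun (_ : ℝ) (x : Fin m × ℤ →ᵇ ℝ) => F x) t) (closedBall 0 (B + 1)) :=
    fun _ _ => lipschitzOnWith_weightedField hε ⟨hwpos, hrat⟩ hMα hα (by linarith)
  have hbdd : ∀ t ∈ Icc (0 : ℝ) c, ∀ x ∈ closedBall (0 : Fin m × ℤ →ᵇ ℝ) (B + 1),
      ‖(fun (_ : ℝ) (x : Fin m × ℤ →ᵇ ℝ) => F x) t x‖ ≤
        ((⟨8 * (m : ℝ) ^ 2 * Mα * A * (B + 1) * (B + 1), by positivity⟩ : ℝ≥0) : ℝ) := by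
    intro t _ x hx
    rw [mem_closedBall, dist_zero_right] at hx
    refine (norm_weightedField_le hε ⟨hwpos, hrat⟩ hMα hα hA x).trans ?_
    show 8 * (m : ℝ) ^ 2 * Mα * A * ‖x‖ * ‖x‖ ≤ 8 * (m : ℝ) ^ 2 * Mα * A * (B + 1) * (B + 1)
    have h1 : 0 ≤ 8 * (m : ℝ) ^ 2 * Mα * A := by positivity
    have h2 : ‖x‖ * ‖x‖ ≤ (B + 1) * (B + 1) :=
      mul_le_mul hx hx (norm_nonneg _) (by linarith)
    nlinarith
  obtain ⟨T, hT, hT0⟩ := Literature.Analysis.ODE.solution_extend (v := fun _ x => F x) le_rfl hc.le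
    (Literature.Analysis.ODE.solution_const (fun _ x => F x) 0 T₀) (R := B) hlip
    (fun _ _ => continuousOn_const) hbdd
    (fun s hs β hβ hβα t ht => hapriori s ⟨hs.1, hs.2⟩ β (hβα (left_mem_Icc.2 le_rfl)) hβ t ht)
  have hT00 : T 0 = T₀ := hT0 (left_mem_Icc.2 le_rfl)
  -- the weighted bound along the solution
  have hTB : ∀ s ∈ Icc 0 c, ‖T s‖ ≤ B := hapriori c ⟨hc.le, le_rfl⟩ T hT00 hT
  -- the unweighted family
  refine ⟨fun i k s => T s (i, k) / w k, ?_, fun s hs i k => ?_⟩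
  swap
  · rw [abs_div, abs_of_pos (hwpos k), mul_div_cancel₀ _ (hwpos k).ne']
    exact ((Real.norm_eq_abs _).symm.le.trans ((T s).norm_coe_le_norm (i, k))).trans (hTB s hs)
  -- coordinates: derivative within `[0,c]`
  have hcoord : ∀ (i : Fin m) (k : ℤ), ∀ s ∈ Icc 0 c,
      HasDerivWithinAt (fun t => T t (i, k) / w k)
        (quadTerm ε₀ α (fun j n (_ : ℝ) => T s (j, n) / w n) i k 0) (Icc 0 c) s := by
    intro i k s hs
    have h0 := ((BoundedContinuousFunction.evalCLM ℝ (i, k) :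
        (Fin m × ℤ →ᵇ ℝ) →L[ℝ] ℝ).hasFDerivAt).comp_hasDerivWithinAt s (hT s hs)
    have h1 : HasDerivWithinAt (fun t => T t (i, k)) (F (T s) (i, k)) (Icc 0 c) s := by
      simpa [Function.comp_def] using h0
    have h2 := h1.div_const (w k)
    rw [hF, weightedField_apply, mul_div_cancel_left₀ _ (hwpos k).ne'] at h2
    exact h2
  -- continuity of the right-hand side along the solution
  have hTcont : ContinuousOn T (Icc 0 c) := fun s hs => (hT s hs).continuousWithinAt
  have hrhs_cont : ∀ (i : Fin m) (k : ℤ),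
      ContinuousOn (fun s => quadTerm ε₀ α (fun j n (_ : ℝ) => T s (j, n) / w n) i k 0) (Icc 0 c) := by
    intro i k
    have hc' : ∀ (j : Fin m) (n : ℤ), ContinuousOn (fun s => T s (j, n) / w n) (Icc 0 c) :=
      fun j n => (((BoundedContinuousFunction.evalCLM ℝ (j, n) :
        (Fin m × ℤ →ᵇ ℝ) →L[ℝ] ℝ).continuous).comp_continuousOn hTcont).div_const _
    simp only [quadTerm]
    refine continuousOn_finsetSum _ fun i₁ _ => continuousOn_finsetSum _ fun i₂ _ =>
      continuousOn_finsetSum _ fun μ _ => ?_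
    exact (continuousOn_const.mul ((hc' _ _).mul (hc' _ _)))
  refine
    { contDiffOn_S := fun i k => contDiffOn_one_Icc_of_hasDerivWithinAt hc (hcoord i k) (hrhs_cont i k)
      contDiffOn_F := fun i k => ?_
      nonneg_F := fun i k s _ => by positivity
      apriori_S := ⟨D * B, fun s hs i k => ?_⟩
      apriori_F := ⟨D * B, fun s hs i k => ?_⟩
      init_S := fun i k => by
        show T 0 (i, k) / w k = S₀ i k
        rw [hT00, hT₀, mul_div_cancel_left₀ _ (hwpos k).ne']
      init_F := fun i k => by
        show (1 / 2) * (T 0 (i, k) / w k) ^ 2 = (1 / 2) * S₀ i k ^ 2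
        rw [hT00, hT₀, mul_div_cancel_left₀ _ (hwpos k).ne']
      motion := fun i k s hs => by
        rw [(hcoord i k s hs).derivWithin (uniqueDiffOn_Icc hc s hs)]
        simp only [quadTerm, sub_self, abs_zero, zero_mul, le_refl]
      energy := fun i k s hs => by
        have h := ((hcoord i k s hs).pow 2).const_mul (1 / 2 : ℝ)
        have h' : HasDerivWithinAt (fun t => (1 / 2) * (T t (i, k) / w k) ^ 2)
            (quadTerm ε₀ α (fun j n (_ : ℝ) => T s (j, n) / w n) i k 0 * (T s (i, k) / w k))
            (Icc 0 c) s :=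
          h.congr_deriv (by rw [show (2 : ℕ) - 1 = 1 from rfl, pow_one, Nat.cast_ofNat]; ring)
        show derivWithin (fun t => (1 / 2) * (T t (i, k) / w k) ^ 2) (Icc 0 c) s ≤ _
        rw [h'.derivWithin (uniqueDiffOn_Icc hc s hs)]
        exact le_of_eq rfl
      defect_lower := fun i k s _ => le_rfl
      defect_upper := fun i k s _ => by simp }
  · -- `F = ½ S²` is `C¹`
    have h2 : ∀ s ∈ Icc 0 c, HasDerivWithinAt (fun t => (1 / 2) * (T t (i, k) / w k) ^ 2)
        ((1 / 2) * (↑(2 : ℕ) * (T s (i, k) / w k) ^ (2 - 1) *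
          quadTerm ε₀ α (fun j n (_ : ℝ) => T s (j, n) / w n) i k 0)) (Icc 0 c) s :=
      fun s hs => ((hcoord i k s hs).pow 2).const_mul (1 / 2 : ℝ)
    refine contDiffOn_one_Icc_of_hasDerivWithinAt hc h2 ?_
    have hc' : ContinuousOn (fun s => T s (i, k) / w k) (Icc 0 c) :=
      (((BoundedContinuousFunction.evalCLM ℝ (i, k) :
        (Fin m × ℤ →ᵇ ℝ) →L[ℝ] ℝ).continuous).comp_continuousOn hTcont).div_const _
    exact continuousOn_const.mul ((continuousOn_const.mul (hc'.pow _)).mul (hrhs_cont i k))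
  · -- a priori bound on the amplitudes
    have h1 : |T s (i, k) / w k| ≤ B / w k := by
      rw [abs_div, abs_of_pos (hwpos k)]
      exact div_le_div_of_nonneg_right
        (((Real.norm_eq_abs _).symm.le.trans ((T s).norm_coe_le_norm (i, k))).trans (hTB s hs))
        (hwpos k).le
    have hpow : 0 ≤ 1 + (1 + ε₀) ^ ((10 : ℝ) * k) := by positivity
    calc (1 + (1 + ε₀) ^ ((10 : ℝ) * k)) * |T s (i, k) / w k|
        ≤ (1 + (1 + ε₀) ^ ((10 : ℝ) * k)) * (B / w k) := mul_le_mul_of_nonneg_left h1 hpow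
      _ = (1 + (1 + ε₀) ^ ((10 : ℝ) * k)) / w k * B := by ring
      _ ≤ D * B := mul_le_mul_of_nonneg_right (hD k) hB0
  · -- a priori bound on the energies
    have h1 : |T s (i, k) / w k| ≤ B / w k := by
      rw [abs_div, abs_of_pos (hwpos k)]
      exact div_le_div_of_nonneg_right
        (((Real.norm_eq_abs _).symm.le.trans ((T s).norm_coe_le_norm (i, k))).trans (hTB s hs))
        (hwpos k).le
    have hpow : 0 ≤ 1 + (1 + ε₀) ^ ((10 : ℝ) * k) := by positivity
    have hsq : Real.sqrt ((1 / 2) * (T s (i, k) / w k) ^ 2) ≤ |T s (i, k) / w k| :=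
      calc Real.sqrt ((1 / 2 : ℝ) * (T s (i, k) / w k) ^ 2) ≤ Real.sqrt ((T s (i, k) / w k) ^ 2) :=
            Real.sqrt_le_sqrt (by nlinarith [sq_nonneg (T s (i, k) / w k)])
        _ = |T s (i, k) / w k| := Real.sqrt_sq_eq_abs _
    calc (1 + (1 + ε₀) ^ ((10 : ℝ) * k)) * Real.sqrt ((1 / 2) * (T s (i, k) / w k) ^ 2)
        ≤ (1 + (1 + ε₀) ^ ((10 : ℝ) * k)) * (B / w k) := mul_le_mul_of_nonneg_left (hsq.trans h1) hpow
      _ = (1 + (1 + ε₀) ^ ((10 : ℝ) * k)) / w k * B := by ring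
      _ ≤ D * B := mul_le_mul_of_nonneg_right (hD k) hB0

/-- Admissible weight ratios force `A ≥ 0`. [folklore] -/
private theorem WeightRatiosLE.nonneg {ε₀ A : ℝ} {w : ℤ → ℝ} (hε : 0 ≤ 1 + ε₀)
    (hw : WeightRatiosLE ε₀ w A) : 0 ≤ A :=
  le_trans (div_nonneg (Real.rpow_nonneg hε _) (hw.1 0).le) (hw.2 0).1

/-- **Short-time a priori bound** (continuity argument): if `‖T₀‖ ≤ B` and the window satisfies
`8 m² M_α A (2B+1)² · c ≤ B + 1/2`, every solution of the conjugated equation from `T₀` on any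
`[0,s] ⊆ [0,c]` stays in the ball `‖T‖ ≤ 2B + 1` (bounded speed `≤ 8 m² M_α A (2B+1)²` inside the ball,
maximal-time exit principle). [cite: Teschl2012, Thm 2.2 (Picard–Lindelöf, the a priori confinement step); folklore] -/
theorem weightedField_apriori_short {ε₀ A Mα B c : ℝ} {α : Fin m → Fin m → Fin m → ℤ × ℤ × ℤ → ℝ}
    {w : ℤ → ℝ} (hε : 0 ≤ 1 + ε₀) (hw : WeightRatiosLE ε₀ w A) (hMα : 0 ≤ Mα)
    (hα : ∀ i₁ i₂ i₃ μ, |α i₁ i₂ i₃ μ| ≤ Mα) {T₀ : Fin m × ℤ →ᵇ ℝ} (hB : ‖T₀‖ ≤ B)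
    (hcL : 8 * (m : ℝ) ^ 2 * Mα * A * (2 * B + 1) * (2 * B + 1) * c ≤ B + 1 / 2) :
    ∀ s ∈ Icc 0 c, ∀ T : ℝ → (Fin m × ℤ →ᵇ ℝ), T 0 = T₀ →
      (∀ t ∈ Icc 0 s, HasDerivWithinAt T (weightedField hε hw hMα hα (T t)) (Icc 0 s) t) →
        ∀ t ∈ Icc 0 s, ‖T t‖ ≤ 2 * B + 1 := by
  intro s hs T hT0 hT t ht
  have hA : 0 ≤ A := WeightRatiosLE.nonneg hε hw
  have hB0 : 0 ≤ B := (norm_nonneg _).trans hB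
  set R : ℝ := 2 * B + 1 with hR
  set L : ℝ := 8 * (m : ℝ) ^ 2 * Mα * A * R * R with hL
  have hL0 : 0 ≤ L := by positivity
  have hcont : ContinuousOn T (Icc 0 s) := fun u hu => (hT u hu).continuousWithinAt
  have hP0 : ‖T 0‖ ≤ R := by rw [hT0]; linarith
  rcases eq_or_lt_of_le hs.1 with hs0 | hs0
  · -- degenerate window `s = 0`
    have ht0 : t = 0 := le_antisymm (hs0 ▸ ht.2) ht.1
    rw [ht0]
    exact hP0
  set τ := Literature.Analysis.ODE.maximalTimeP (fun u => ‖T u‖ ≤ R) 0 s with hτ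
  have hclosed : ∀ u ∈ Ioc 0 s, (∀ v ∈ Ico 0 u, ‖T v‖ ≤ R) → ‖T u‖ ≤ R := by
    intro u hu hprev
    have hcu : ContinuousWithinAt (fun v => ‖T v‖) (Ico 0 u) u :=
      ((hcont u ⟨hu.1.le, hu.2⟩).norm).mono fun v hv => ⟨hv.1, hv.2.le.trans hu.2⟩
    haveI : (𝓝[Ico 0 u] u).NeBot := by
      rw [← mem_closure_iff_nhdsWithin_neBot, closure_Ico hu.1.ne, right_mem_Icc]
      exact hu.1.le
    exact le_of_tendsto hcu (Filter.eventually_of_mem self_mem_nhdsWithin hprev)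
  have hτmem : τ ∈ Icc 0 s := Literature.Analysis.ODE.maximalTimeP_mem hs0.le hP0
  have hPτ : ∀ u ∈ Icc 0 τ, ‖T u‖ ≤ R := fun u hu =>
    Literature.Analysis.ODE.maximalTimeP_spec hs0.le hP0 hclosed hu
  -- improved bound on `[0, τ]` from the bounded speed
  have himp : ∀ u ∈ Icc 0 τ, ‖T u‖ ≤ R - 1 / 2 := by
    intro u hu
    have hsol : ∀ v ∈ Icc 0 τ, HasDerivWithinAt T (weightedField hε hw hMα hα (T v)) (Icc 0 τ) v :=
      fun v hv => (hT v ⟨hv.1, hv.2.trans hτmem.2⟩).mono (Icc_subset_Icc_right hτmem.2)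
    have hspeed : ∀ v ∈ Icc 0 τ, ‖weightedField hε hw hMα hα (T v)‖ ≤ L := by
      intro v hv
      refine (norm_weightedField_le hε hw hMα hα hA (T v)).trans ?_
      have h1 : ‖T v‖ ≤ R := hPτ v hv
      have h2 : 0 ≤ 8 * (m : ℝ) ^ 2 * Mα * A := by positivity
      have h3 : ‖T v‖ * ‖T v‖ ≤ R * R := mul_le_mul h1 h1 (norm_nonneg _) (by linarith)
      rw [hL]
      nlinarith
    have hmv := Literature.Analysis.ODE.norm_sub_le_mul_of_hasDerivWithinAt (convex_Icc 0 τ) hsol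
      hspeed (left_mem_Icc.2 hτmem.1) hu
    rw [sub_zero, abs_of_nonneg hu.1, hT0] at hmv
    have hu_c : u ≤ c := hu.2.trans (hτmem.2.trans hs.2)
    have hLu : L * u ≤ B + 1 / 2 := by
      calc L * u ≤ L * c := mul_le_mul_of_nonneg_left hu_c hL0
        _ ≤ B + 1 / 2 := by rw [hL]; linarith
    calc ‖T u‖ = ‖(T u - T₀) + T₀‖ := by rw [sub_add_cancel]
      _ ≤ ‖T u - T₀‖ + ‖T₀‖ := norm_add_le _ _
      _ ≤ L * u + B := add_le_add hmv hB
      _ ≤ R - 1 / 2 := by linarith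
  -- exit principle: `τ = s`
  have hτs : τ = s := by
    rcases Literature.Analysis.ODE.maximalTimeP_exit (P := fun u => ‖T u‖ ≤ R) hs0.le hP0 with h | h
    · exact h
    · exfalso
      apply h
      have hcτ : ContinuousWithinAt (fun v => ‖T v‖) (Icc 0 s) τ := (hcont τ hτmem).norm
      have hlt : ‖T τ‖ < R := by linarith [himp τ ⟨hτmem.1, le_rfl⟩]
      exact (hcτ.eventually_mem (Iio_mem_nhds hlt)).mono fun v hv => le_of_lt hv
  exact hPτ t ⟨ht.1, ht.2.trans_eq hτs.symm⟩

/-- **LOCAL EXISTENCE OF EXACT LATTICE FLOWS** (no dynamical hypothesis): for admissible weights with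
`(1 + (1+ε₀)^{10k})/w_k ≤ D`, bounded structure constants, and a weighted state `T₀ = w·S₀` with
`‖T₀‖ ≤ B`, the lattice has an EXACT flow `PseudoFlowOn c ε₀ α 0 0 S₀ (½S₀²) 0 S (½S²)` on every window
`0 < c` with `8 m² M_α A (2B+1)² · c ≤ B + 1/2`, obeying `w_k |S_{i,k}| ≤ 2B + 1` throughout. (The (front)
/ (exist₀) clause of the certificate formats for SHORT windows; long windows need the a priori bound
of `exists_exact_pseudoFlowOn_of_apriori_bound`.) [cite: Tao2016AveragedNS, §4 Lemma 4.1 (4.5), (4.8), (4.12); Teschl2012, Thm 2.2] -/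
theorem exists_exact_pseudoFlowOn_short {ε₀ A Mα D B c : ℝ}
    {α : Fin m → Fin m → Fin m → ℤ × ℤ × ℤ → ℝ} {w : ℤ → ℝ}
    (hε : 0 ≤ 1 + ε₀) (hw : WeightRatiosLE ε₀ w A) (hMα : 0 ≤ Mα)
    (hα : ∀ i₁ i₂ i₃ μ, |α i₁ i₂ i₃ μ| ≤ Mα)
    (hD : ∀ k : ℤ, (1 + (1 + ε₀) ^ ((10 : ℝ) * k)) / w k ≤ D) (hc : 0 < c)
    (S₀ : Fin m → ℤ → ℝ) (T₀ : Fin m × ℤ →ᵇ ℝ) (hT₀ : ∀ i k, T₀ (i, k) = w k * S₀ i k)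
    (hB : ‖T₀‖ ≤ B) (hcL : 8 * (m : ℝ) ^ 2 * Mα * A * (2 * B + 1) * (2 * B + 1) * c ≤ B + 1 / 2) :
    ∃ S : Fin m → ℤ → ℝ → ℝ,
      PseudoFlowOn c ε₀ α 0 0 S₀ (fun i k => (1 / 2) * S₀ i k ^ 2) (fun _ _ => 0) S
        (fun i k s => (1 / 2) * S i k s ^ 2) ∧
      ∀ s ∈ Icc 0 c, ∀ i k, w k * |S i k s| ≤ 2 * B + 1 :=
  exists_exact_pseudoFlowOn_of_apriori_bound hε hw hMα hα hD hc S₀ T₀ hT₀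
    (hB.trans (by linarith [(norm_nonneg _).trans hB]))
    (weightedField_apriori_short hε hw hMα hα hB hcL)

/-! ### Tables bounded on the shift set only (e.g. the class `E₂(R)`)

`quadTerm` reads the structure constants on the shift set `S` alone, so every table may be replaced by its
restriction to `S` (zero elsewhere); for the restricted table the uniform bound of the previous section is
the bound ON `S`, which for `InTableClass R α` is `1`. -/

/-- The restriction of a table to the shift set (zero off `S`). [cite: Tao2016AveragedNS, §4 after (4.1) (only shifts in `S` occur)] -/
def restrictShiftSet (α : Fin m → Fin m → Fin m → ℤ × ℤ × ℤ → ℝ) :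
    Fin m → Fin m → Fin m → ℤ × ℤ × ℤ → ℝ :=
  fun i₁ i₂ i₃ μ => if μ ∈ shiftSet then α i₁ i₂ i₃ μ else 0

/-- `quadTerm` only sees the shift set: the restricted table drives the same nonlinearity.
[cite: Tao2016AveragedNS, §4 (4.8)] -/
theorem quadTerm_restrictShiftSet (ε₀ : ℝ) (α : Fin m → Fin m → Fin m → ℤ × ℤ × ℤ → ℝ)
    (X : Fin m → ℤ → ℝ → ℝ) (i : Fin m) (n : ℤ) (t : ℝ) :
    quadTerm ε₀ (restrictShiftSet α) X i n t = quadTerm ε₀ α X i n t := by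
  unfold quadTerm restrictShiftSet
  refine Finset.sum_congr rfl fun i₁ _ => Finset.sum_congr rfl fun i₂ _ =>
    Finset.sum_congr rfl fun μ hμ => ?_
  rw [if_pos hμ]

/-- A bound on the shift set is a uniform bound for the restricted table.
[cite: Tao2016AveragedNS, §4 after (4.1); cell vocabulary] -/
theorem abs_restrictShiftSet_le {α : Fin m → Fin m → Fin m → ℤ × ℤ × ℤ → ℝ} {Mα : ℝ} (hMα : 0 ≤ Mα)
    (hα : ∀ i₁ i₂ i₃ μ, μ ∈ shiftSet → |α i₁ i₂ i₃ μ| ≤ Mα) :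
    ∀ i₁ i₂ i₃ μ, |restrictShiftSet α i₁ i₂ i₃ μ| ≤ Mα := by
  intro i₁ i₂ i₃ μ
  unfold restrictShiftSet
  split_ifs with h
  · exact hα i₁ i₂ i₃ μ h
  · rw [abs_zero]; exact hMα

/-- Tables of the class `E₂(R)` have structure constants of modulus `≤ 1` on the shift set.
[cite: Tao2016AveragedNS, §6.1 (the table being compared); cell vocabulary] -/
theorem abs_le_one_of_inTableClass {R : ℝ} {α : Fin m → Fin m → Fin m → ℤ × ℤ × ℤ → ℝ}
    (h : InTableClass R α) : ∀ i₁ i₂ i₃ μ, μ ∈ shiftSet → |α i₁ i₂ i₃ μ| ≤ 1 :=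
  fun i₁ i₂ i₃ μ hμ => (h.2.2 i₁ i₂ i₃ μ hμ).1

/-- A pseudo-flow of the restricted table is a pseudo-flow of the table (same nonlinearity).
[cite: Tao2016AveragedNS, §4 Lemma 4.1 (4.8)–(4.10); cell vocabulary] -/
theorem PseudoFlowOn.of_restrictShiftSet {τ ε₀ κ₁ κ₂ : ℝ}
    {α : Fin m → Fin m → Fin m → ℤ × ℤ × ℤ → ℝ} {S₀ F₀ B₀ : Fin m → ℤ → ℝ}
    {S F : Fin m → ℤ → ℝ → ℝ} (h : PseudoFlowOn τ ε₀ (restrictShiftSet α) κ₁ κ₂ S₀ F₀ B₀ S F) :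
    PseudoFlowOn τ ε₀ α κ₁ κ₂ S₀ F₀ B₀ S F where
  contDiffOn_S := h.contDiffOn_S
  contDiffOn_F := h.contDiffOn_F
  nonneg_F := h.nonneg_F
  apriori_S := h.apriori_S
  apriori_F := h.apriori_F
  init_S := h.init_S
  init_F := h.init_F
  motion i k s hs := by rw [← quadTerm_restrictShiftSet]; exact h.motion i k s hs
  energy i k s hs := by rw [← quadTerm_restrictShiftSet]; exact h.energy i k s hs
  defect_lower := h.defect_lower
  defect_upper := h.defect_upper

/-- **Local existence of exact flows for a comparable table** (`InTableClass R α`, so `|α| ≤ 1` on `S`):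
the short-window statement `exists_exact_pseudoFlowOn_short` with `M_α = 1`, for the table itself.
[cite: Tao2016AveragedNS, §4 Lemma 4.1 (4.5), (4.8), (4.12); Teschl2012, Thm 2.2] -/
theorem exists_exact_pseudoFlowOn_short_of_inTableClass {ε₀ A D B c R : ℝ}
    {α : Fin m → Fin m → Fin m → ℤ × ℤ × ℤ → ℝ} {w : ℤ → ℝ}
    (hε : 0 ≤ 1 + ε₀) (hw : WeightRatiosLE ε₀ w A) (hαR : InTableClass R α)
    (hD : ∀ k : ℤ, (1 + (1 + ε₀) ^ ((10 : ℝ) * k)) / w k ≤ D) (hc : 0 < c)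
    (S₀ : Fin m → ℤ → ℝ) (T₀ : Fin m × ℤ →ᵇ ℝ) (hT₀ : ∀ i k, T₀ (i, k) = w k * S₀ i k)
    (hB : ‖T₀‖ ≤ B) (hcL : 8 * (m : ℝ) ^ 2 * 1 * A * (2 * B + 1) * (2 * B + 1) * c ≤ B + 1 / 2) :
    ∃ S : Fin m → ℤ → ℝ → ℝ,
      PseudoFlowOn c ε₀ α 0 0 S₀ (fun i k => (1 / 2) * S₀ i k ^ 2) (fun _ _ => 0) S
        (fun i k s => (1 / 2) * S i k s ^ 2) ∧
      ∀ s ∈ Icc 0 c, ∀ i k, w k * |S i k s| ≤ 2 * B + 1 := by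
  obtain ⟨S, hS, hb⟩ := exists_exact_pseudoFlowOn_short hε hw zero_le_one
    (abs_restrictShiftSet_le zero_le_one (abs_le_one_of_inTableClass hαR)) hD hc S₀ T₀ hT₀ hB hcL
  exact ⟨S, hS.of_restrictShiftSet, hb⟩

/-! ### Certificate-style weights are admissible

Weights of the kind used by the tree's certificate formats — `w ≥ 1`, super-geometric growth ahead of the
front ((T1) of `TailFat`/`TailCompat`: `2(1+ε₀)^k w_k ≤ w_{k+1}`), the thin-tail bound
`(1+ε₀)^{5(k+2)/2} r w_{k+1} ≤ ϑ w_k²` (`TailThin` with one threshold) and tameness behind the front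
(`w_k ≤ C(1+ε₀)^{-k}` for `k ≤ 0`, the weight half of `TameBehind`) — satisfy `WeightRatiosLE` with an
explicit `A`, when the thresholds sit at the front (`k ≥ 0`; a designer can always arrange this). -/

/-- Super-geometric growth from the front forces `w_n ≥ (1+ε₀)^{n(n-1)/2}` for `n ≥ 0`. [folklore] -/
private theorem weight_lower_of_growth {ε₀ : ℝ} {w : ℤ → ℝ} (hε : 0 ≤ ε₀) (hw1 : ∀ k, 1 ≤ w k)
    (hgrow : ∀ k : ℤ, 0 ≤ k → 2 * (1 + ε₀) ^ (k : ℝ) * w k ≤ w (k + 1)) (n : ℕ) :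
    (1 + ε₀) ^ ((n : ℝ) * ((n : ℝ) - 1) / 2) ≤ w n := by
  have hb : 0 < 1 + ε₀ := by linarith
  induction n with
  | zero => simpa using hw1 0
  | succ n ih =>
    have hg := hgrow n (by exact_mod_cast Nat.zero_le n)
    have hpow : 0 ≤ (1 + ε₀) ^ ((n : ℤ) : ℝ) := Real.rpow_nonneg hb.le _
    have h1 : (1 + ε₀) ^ ((n : ℤ) : ℝ) * (1 + ε₀) ^ ((n : ℝ) * ((n : ℝ) - 1) / 2) ≤ w ((n : ℤ) + 1) := by
      calc (1 + ε₀) ^ ((n : ℤ) : ℝ) * (1 + ε₀) ^ ((n : ℝ) * ((n : ℝ) - 1) / 2)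
          ≤ (1 + ε₀) ^ ((n : ℤ) : ℝ) * w n := mul_le_mul_of_nonneg_left ih hpow
        _ ≤ 2 * (1 + ε₀) ^ ((n : ℤ) : ℝ) * w n := by
            have : 0 ≤ (1 + ε₀) ^ ((n : ℤ) : ℝ) * w n := mul_nonneg hpow (by linarith [hw1 n])
            linarith
        _ ≤ w ((n : ℤ) + 1) := hg
    have h2 : (1 + ε₀) ^ ((n : ℤ) : ℝ) * (1 + ε₀) ^ ((n : ℝ) * ((n : ℝ) - 1) / 2) =
        (1 + ε₀) ^ ((((n + 1 : ℕ)) : ℝ) * ((((n + 1 : ℕ)) : ℝ) - 1) / 2) := by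
      rw [← Real.rpow_add hb]
      congr 1
      push_cast
      ring
    rw [h2] at h1
    simpa using h1

/-- **Certificate-style weights are admissible**: `w ≥ 1`, growth `2(1+ε₀)^k w_k ≤ w_{k+1}` and thin tail
`(1+ε₀)^{5(k+2)/2} r w_{k+1} ≤ ϑ w_k²` for `k ≥ 0`, and `w_k ≤ C(1+ε₀)^{-k}` for `k ≤ 0` give
`WeightRatiosLE ε₀ w ((1+ε₀)^{9/2} + (1+ε₀)^2 + C + ϑ/r)`. [cite: Tao2016AveragedNS, §6.2 Prop. 6.3 (ix) (weights ahead of the front, statement shape); cell vocabulary] -/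
theorem weightRatiosLE_of_certificate_weights {ε₀ r ϑ C : ℝ} {w : ℤ → ℝ} (hε : 0 ≤ ε₀) (hr : 0 < r)
    (hw1 : ∀ k, 1 ≤ w k)
    (hgrow : ∀ k : ℤ, 0 ≤ k → 2 * (1 + ε₀) ^ (k : ℝ) * w k ≤ w (k + 1))
    (hthin : ∀ k : ℤ, 0 ≤ k → (1 + ε₀) ^ ((5 : ℝ) * (k + 2) / 2) * r * w (k + 1) ≤ ϑ * w k ^ 2)
    (htame : ∀ k : ℤ, k ≤ 0 → w k ≤ C * (1 + ε₀) ^ (-(k : ℝ))) :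
    WeightRatiosLE ε₀ w ((1 + ε₀) ^ ((9 : ℝ) / 2) + (1 + ε₀) ^ (2 : ℝ) + C + ϑ / r) := by
  have hb : 0 < 1 + ε₀ := by linarith
  have hb1 : 1 ≤ 1 + ε₀ := by linarith
  have hwpos : ∀ k, 0 < w k := fun k => lt_of_lt_of_le one_pos (hw1 k)
  have hC : 0 ≤ C := by
    have h := htame 0 le_rfl
    simp only [Int.cast_zero, neg_zero, Real.rpow_zero, mul_one] at h
    linarith [hw1 0]
  have hϑ : 0 ≤ ϑ := by
    have h := hthin 0 le_rfl
    have h1 : 0 < (1 + ε₀) ^ ((5 : ℝ) * ((0 : ℤ) + 2) / 2) * r * w (0 + 1) := by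
      have := hwpos (0 + 1); positivity
    have h2 : 0 < w 0 ^ 2 := by have := hwpos 0; positivity
    nlinarith
  have hA9 : 0 ≤ (1 + ε₀) ^ ((9 : ℝ) / 2) := Real.rpow_nonneg hb.le _
  have hA2 : 0 ≤ (1 + ε₀) ^ (2 : ℝ) := Real.rpow_nonneg hb.le _
  have hϑr : 0 ≤ ϑ / r := div_nonneg hϑ hr.le
  -- exponent comparison for base ≥ 1
  have hexp : ∀ {p q : ℝ}, p ≤ q → (1 + ε₀) ^ p ≤ (1 + ε₀) ^ q := fun h =>
    Real.rpow_le_rpow_of_exponent_le hb1 h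
  have hone : ∀ {p : ℝ}, p ≤ 0 → (1 + ε₀) ^ p ≤ 1 := fun {p} h => by
    have := hexp h; rwa [Real.rpow_zero] at this
  -- lower bound on the weights ahead of the front
  have hwlow : ∀ k : ℤ, 0 ≤ k → (1 + ε₀) ^ ((k : ℝ) * ((k : ℝ) - 1) / 2) ≤ w k := by
    intro k hk
    obtain ⟨n, rfl⟩ := Int.eq_ofNat_of_zero_le hk
    have := weight_lower_of_growth hε hw1 hgrow n
    simpa using this
  refine ⟨hwpos, fun k => ⟨?_, ?_, ?_⟩⟩
  · -- same-shell ratio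
    have hgoal : (1 + ε₀) ^ ((5 : ℝ) * k / 2) / w k ≤ (1 + ε₀) ^ ((9 : ℝ) / 2) := by
      rcases le_or_gt 0 k with hk | hk
      · have hlow := hwlow k hk
        have hpos : 0 < (1 + ε₀) ^ ((k : ℝ) * ((k : ℝ) - 1) / 2) := Real.rpow_pos_of_pos hb _
        calc (1 + ε₀) ^ ((5 : ℝ) * k / 2) / w k
            ≤ (1 + ε₀) ^ ((5 : ℝ) * k / 2) / (1 + ε₀) ^ ((k : ℝ) * ((k : ℝ) - 1) / 2) :=
              div_le_div_of_nonneg_left (Real.rpow_nonneg hb.le _) hpos hlow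
          _ = (1 + ε₀) ^ ((5 : ℝ) * k / 2 - (k : ℝ) * ((k : ℝ) - 1) / 2) := by
              rw [Real.rpow_sub hb]
          _ ≤ (1 + ε₀) ^ ((9 : ℝ) / 2) := hexp (by nlinarith [sq_nonneg ((k : ℝ) - 3)])
      · have hk' : (k : ℝ) ≤ 0 := by exact_mod_cast hk.le
        calc (1 + ε₀) ^ ((5 : ℝ) * k / 2) / w k ≤ (1 + ε₀) ^ ((5 : ℝ) * k / 2) / 1 :=
              div_le_div_of_nonneg_left (Real.rpow_nonneg hb.le _) one_pos (hw1 k)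
          _ ≤ 1 := by rw [div_one]; exact hone (by nlinarith)
          _ ≤ (1 + ε₀) ^ ((9 : ℝ) / 2) := Real.one_le_rpow hb1 (by norm_num)
    linarith
  · -- back-reaction ratio
    have hgoal : (1 + ε₀) ^ ((5 : ℝ) * k / 2) / w (k + 1) ≤ (1 + ε₀) ^ (2 : ℝ) := by
      rcases le_or_gt 0 k with hk | hk
      · have hlow := hwlow (k + 1) (by omega)
        have hpos : 0 < (1 + ε₀) ^ ((((k + 1 : ℤ)) : ℝ) * ((((k + 1 : ℤ)) : ℝ) - 1) / 2) :=
          Real.rpow_pos_of_pos hb _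
        calc (1 + ε₀) ^ ((5 : ℝ) * k / 2) / w (k + 1)
            ≤ (1 + ε₀) ^ ((5 : ℝ) * k / 2) /
                (1 + ε₀) ^ ((((k + 1 : ℤ)) : ℝ) * ((((k + 1 : ℤ)) : ℝ) - 1) / 2) :=
              div_le_div_of_nonneg_left (Real.rpow_nonneg hb.le _) hpos hlow
          _ = (1 + ε₀) ^ ((5 : ℝ) * k / 2 - (((k + 1 : ℤ)) : ℝ) * ((((k + 1 : ℤ)) : ℝ) - 1) / 2) := by
              rw [Real.rpow_sub hb]
          _ ≤ (1 + ε₀) ^ (2 : ℝ) := hexp (by push_cast; nlinarith [sq_nonneg ((k : ℝ) - 2)])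
      · have hk' : (k : ℝ) ≤ -1 := by exact_mod_cast (show k ≤ -1 by omega)
        calc (1 + ε₀) ^ ((5 : ℝ) * k / 2) / w (k + 1) ≤ (1 + ε₀) ^ ((5 : ℝ) * k / 2) / 1 :=
              div_le_div_of_nonneg_left (Real.rpow_nonneg hb.le _) one_pos (hw1 (k + 1))
          _ ≤ 1 := by rw [div_one]; exact hone (by nlinarith)
          _ ≤ (1 + ε₀) ^ (2 : ℝ) := Real.one_le_rpow hb1 (by norm_num)
    linarith
  · -- pump ratio
    have hgoal : (1 + ε₀) ^ ((5 : ℝ) * ((k : ℝ) - 1) / 2) * w k / w (k - 1) ^ 2 ≤ C + ϑ / r := by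
      rcases le_or_gt 1 k with hk | hk
      · -- thin tail at `k - 1 ≥ 0`
        have ht := hthin (k - 1) (by omega)
        have hwk1 : 0 < w (k - 1) ^ 2 := by have := hwpos (k - 1); positivity
        have hcast : (((k - 1 : ℤ)) : ℝ) = (k : ℝ) - 1 := by push_cast; ring
        rw [show k - 1 + 1 = k by ring, hcast] at ht
        -- `(1+ε₀)^{5(k+1)/2} r w_k ≤ ϑ w_{k-1}²`
        have hratio : w k / w (k - 1) ^ 2 ≤ ϑ / (r * (1 + ε₀) ^ ((5 : ℝ) * ((k : ℝ) - 1 + 2) / 2)) := by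
          rw [div_le_div_iff₀ hwk1 (by positivity)]
          nlinarith [ht]
        have hp5 : 0 < (1 + ε₀) ^ ((5 : ℝ) * ((k : ℝ) - 1 + 2) / 2) := Real.rpow_pos_of_pos hb _
        calc (1 + ε₀) ^ ((5 : ℝ) * ((k : ℝ) - 1) / 2) * w k / w (k - 1) ^ 2
            = (1 + ε₀) ^ ((5 : ℝ) * ((k : ℝ) - 1) / 2) * (w k / w (k - 1) ^ 2) := by ring
          _ ≤ (1 + ε₀) ^ ((5 : ℝ) * ((k : ℝ) - 1) / 2) *
                (ϑ / (r * (1 + ε₀) ^ ((5 : ℝ) * ((k : ℝ) - 1 + 2) / 2))) :=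
              mul_le_mul_of_nonneg_left hratio (Real.rpow_nonneg hb.le _)
          _ = ϑ / r * ((1 + ε₀) ^ ((5 : ℝ) * ((k : ℝ) - 1) / 2) /
                (1 + ε₀) ^ ((5 : ℝ) * ((k : ℝ) - 1 + 2) / 2)) := by
              field_simp
          _ = ϑ / r * (1 + ε₀) ^ ((5 : ℝ) * ((k : ℝ) - 1) / 2 - (5 : ℝ) * ((k : ℝ) - 1 + 2) / 2) := by
              rw [Real.rpow_sub hb]
          _ ≤ ϑ / r * 1 := mul_le_mul_of_nonneg_left (hone (by linarith)) hϑr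
          _ ≤ C + ϑ / r := by linarith
      · -- behind the front: `k ≤ 0`
        have hk0 : k ≤ 0 := by omega
        have htk := htame k hk0
        have hw2 : 1 ≤ w (k - 1) ^ 2 := by nlinarith [hw1 (k - 1)]
        have hnum : 0 ≤ (1 + ε₀) ^ ((5 : ℝ) * ((k : ℝ) - 1) / 2) * w k :=
          mul_nonneg (Real.rpow_nonneg hb.le _) (hwpos k).le
        have hk' : (k : ℝ) ≤ 0 := by exact_mod_cast hk0
        calc (1 + ε₀) ^ ((5 : ℝ) * ((k : ℝ) - 1) / 2) * w k / w (k - 1) ^ 2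
            ≤ (1 + ε₀) ^ ((5 : ℝ) * ((k : ℝ) - 1) / 2) * w k / 1 :=
              div_le_div_of_nonneg_left hnum one_pos hw2
          _ ≤ (1 + ε₀) ^ ((5 : ℝ) * ((k : ℝ) - 1) / 2) * (C * (1 + ε₀) ^ (-(k : ℝ))) := by
              rw [div_one]; exact mul_le_mul_of_nonneg_left htk (Real.rpow_nonneg hb.le _)
          _ = C * (1 + ε₀) ^ ((5 : ℝ) * ((k : ℝ) - 1) / 2 + -(k : ℝ)) := by
              rw [Real.rpow_add hb]; ring
          _ ≤ C * 1 := mul_le_mul_of_nonneg_left (hone (by nlinarith)) hC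
          _ ≤ C + ϑ / r := by linarith
    linarith

end TaoCascade

end Literature.Analysis.FluidPDE

end
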